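import Summits.QuantumFields.YangMills.Theorems.BalabanUVNodesN15CovariantLandauObjects
import HarnessLib

/-!
# Route «BalabanUVNodes», node N15 = NE2, road (c) — PROGRAMME (P-R), II: THE GAUGE COVARIANCE OF THE LANDAU OBJECTS — Bałaban's transformation laws (3.31)–(3.34)
# in the model: under `U ↦ U^u` every object of n15-c∕197 is conjugated by the block-diagonal orthogonal matrix of `u` (dag-n15-c g22, n15-c∕198)

Cell `pub-ymgap`, seat `pub-ymgap-dag-n15-c` (generation g22; R134 (a), s1; HUMAN RULING D-0062; chair R424 venue).  `bears_on: R4∕N15 · K3⁸ SpineGivenEndpointR13SepCoPHV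
(stmt-QuantumFields-27366)`; filed `--supports stmt-QuantumFields-27366 --as helper` — COUNT-NEUTRAL.  Finite matrix algebra ([folklore]); three plumbing `def`s (`bdiag`, `gaugeTb`,
`gaugeT`); 0 `sorry`; NO estimate.  Imports BY NAME n15-c∕197 `…N15CovariantLandauObjects` (`cgrad`, `csavg`, `claplA`, `cGreen`, `cSop`, `cPi`, `cR`, `landauCov`; through it
n15-c∕181 `mprod`, `cvaLeg`∕`cvaStair`∕`cvaLine`∕`cvaPath`, the lane's `bondAt`∕`stair`∕`blockCoords`, b05's `bpt`∕`iota`∕`unitVec`).  Nothing in the tree modified ∕ restated.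

WHY (HOME HANDOFF g16 «THE FINDING»: the cover knit's per-cube conjugation row `hP` — `W_k P W_kᵀ = N_L ⊗ 1 − N_V k` in FILE 120 `uN_cvGlued_spec` — is producible for LIVE per-cube
gauges `u_k` only for a COVARIANT summand `P(U)`; with the flat `N_L ⊗ 1` the lane had to retreat to the global small-field gauge `u ≡ 1`).  The print, p. 395–396:
*«Δ^η_{U^u} = R(u)Δ^η_U R(u⁻¹). (3.31) … (Q′_j(U^u)R(u)λ)(y) = R(u(y))(Q′_j(U)λ)(y), (3.32) … G′(U^u) = R(u)G′(U)R(u⁻¹), R(U^u) = R(u)R(U)R(u⁻¹). (3.33) … Δ_a(U^u) =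
R(u)Δ_a(U)R(u⁻¹), G(U^u) = R(u)G(U)R(u⁻¹). (3.34)»*  THIS FILE proves these laws for the MODEL objects of n15-c∕197: a site gauge `W : T_η → O(ι)` (`= coordMat e Ad_{u(x)}`
in the sequel) acts on the site transporters by `T^W_ν(x) = W(x)·T_ν(x)·W(x + e_ν)ᵀ` (`U^u(x, x′) = u(x)U(x, x′)u(x′)⁻¹`, (3.28)), on coloured scalars ∕ 1-forms ∕ coarse scalars
by the block-diagonal orthogonal matrices `𝕎₀ = bdiag W`, `𝕎₁ = bdiag (W ∘ base point of the bond)`, `𝕎_c = bdiag (W ∘ base point of the block)`; then `D`, `Q′`, `Δ′_a`,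
`G′`, `Q′G′²Q′*`, `I − R`, `R`, and the covariant Landau term `D(I − R)D*` are all CONJUGATED — the last one is FILE 120's `hP` row for the Landau summand with LIVE `u_k`.

OBJECTS AND RESULTS ([folklore] algebra; equation tags mark the printed law each theorem transcribes in the model — nothing printed is asserted).
* §1 `bdiag W` (block-diagonal colour action), `bdiag_mul_apply`∕`mul_bdiag_transpose_apply`, `conj_apply`, `sum_conj_smul`, `bdiag_transpose`, `bdiag_mul_bdiag`, `bdiag_one`,
  `bdiag_orth`∕`bdiag_orth'` (fibrewise orthogonal ⇒ orthogonal), `inv_conj_orth` (`(𝕎A𝕎ᵀ)⁻¹ = 𝕎A⁻¹𝕎ᵀ` for orthogonal `𝕎`: Mathlib's total inverse, NO invertibility of `A`).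
* §2 TELESCOPING OF TRANSPORTS: `mprod_telescope`; `gaugeTb W T'` (the action on a bond-indexed datum, for n15-c∕181's `Q(U)`), `gaugeT W T` (on a site datum), `gaugeTb_lift`;
  `iota_stair_succ`, `bpt_stair_succ` (one step up the staircase is `+ e_μ`), `stair_leg_end` (legs abut), `stair_zero`, `stair_last`, ★ `cvaLeg_gauge`,
  ★ `cvaStair_gauge : cvaStair (T'^W) y a ν = W(n·y)·cvaStair T' y a ν·W(n·y + a)ᵀ`, ★ `cvaLine_gauge`, ★ `cvaPath_gauge` ((3.32)'s mechanism «R(U^u(Γ_{y,x})) = R(u(y))R(U(Γ_{y,x}))R(u⁻¹(x))»).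
* §3 ★ `cgrad_gauge : cgrad T^W = 𝕎₁·cgrad T·𝕎₀ᵀ` ((3.31)'s first-order form), ★ `csavg_gauge : csavg T^W = 𝕎_c·csavg T·𝕎₀ᵀ` ((3.32)), `claplA_gauge` ((3.31)∕(3.24)),
  `cGreen_gauge` ((3.33)₁), `cSop_gauge`, ★ `cPi_gauge`, ★ `cR_gauge` ((3.33)₂), ★★ **`landauCov_gauge : landauCov T^W a = 𝕎₁·landauCov T a·𝕎₁ᵀ`** ((3.34) for the Landau summand:
  FILE 120's `hP` row with the per-cube gauge LIVE).

HONEST FRAMING ∕ LIMITS.  Algebra only; no estimate, no positivity (n15-c∕199).  MODEL READING as n15-c∕197 (one averaging level, whole torus, uniform weights, one-level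
staircases, site ∕ component-blind transporters and gauges).  NOT [Balaban1985BackgroundPropagators] Thms 3.1–3.3; NE2⁺ NOT PRINTED; N15 of record untouched (DISCHARGED AS
CONSUMED, p687738); counts UNMOVED (typed 28∕28); one finite 𝕋⁴ at fixed ε per index — NOT infinite volume ∕ OS ∕ mass gap ∕ Clay.  Restate-immune (no Theses import).
-/

noncomputable section

open scoped BigOperators Matrix
open Finset

namespace Summit.QuantumFields.YangMills.BalabanUVNodes.N15.CovLandau

open Literature.MathematicalPhysics.QuantumFieldTheory.Balaban1983to89
open Literature.MathematicalPhysics.QuantumFieldTheory.Balaban1983to89.B5Prop11Plancherel (Tor fine unitVec)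
open Literature.MathematicalPhysics.QuantumFieldTheory.Balaban1983to89.B5Block118 (bpt iota up)
open Literature.MathematicalPhysics.QuantumFieldTheory.King1986.Torus (blockOf)
open Summit.QuantumFields.YangMills.BalabanUVNodes.N15.VectorPiece (bondAt stair stair_of_lt stair_self stair_of_gt blockCoords bpt_blockCoords)
open Summit.QuantumFields.YangMills.BalabanUVNodes.N15.DefectKernel (kingBlockOf_bpt)
open Summit.QuantumFields.YangMills.BalabanUVNodes.N15.CovAvg (mprod mprod_zero mprod_succ mprod_congr cvaLeg cvaStair cvaLine cvaPath)

variable {d : ℕ}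

/-! ## §1 Block-diagonal colour actions -/

section BDiag

variable {ι : Type} [Fintype ι] [DecidableEq ι]

/-- THE BLOCK-DIAGONAL COLOUR ACTION of a site-dependent matrix `W : X → Matrix ι ι ℝ` on coloured fields `X × ι → ℝ` (`= mmulOp W` of the lane as a matrix).
[cite: Balaban1985BackgroundPropagators, (3.28) p.395 («R(u(x))»: shape)] -/
def bdiag {X : Type} [DecidableEq X] (W : X → Matrix ι ι ℝ) : Matrix (X × ι) (X × ι) ℝ := fun p q => if p.1 = q.1 then W p.1 p.2 q.2 else 0

omit [Fintype ι] [DecidableEq ι] in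
/-- Transpose of a block-diagonal action. [folklore] -/
theorem bdiag_transpose {X : Type} [DecidableEq X] (W : X → Matrix ι ι ℝ) : (bdiag W)ᵀ = bdiag fun x => (W x)ᵀ := by
  ext p q
  simp only [bdiag, Matrix.transpose_apply]
  by_cases h : p.1 = q.1
  · rw [if_pos h, if_pos h.symm, h]
  · rw [if_neg h, if_neg (Ne.symm h)]

omit [DecidableEq ι] in
/-- Left action: `(bdiag W · A)((x,i),q) = Σ_j W(x)_{ij} A((x,j),q)`. [folklore] -/
theorem bdiag_mul_apply {X : Type} [Fintype X] [DecidableEq X] (W : X → Matrix ι ι ℝ) {Z : Type} (A : Matrix (X × ι) Z ℝ) (p : X × ι) (q : Z) :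
    (bdiag W * A) p q = ∑ j, W p.1 p.2 j * A (p.1, j) q := by
  rw [Matrix.mul_apply, Fintype.sum_prod_type]
  simp only [bdiag, ite_mul, zero_mul]
  rw [Finset.sum_eq_single p.1 (fun x _ hx => by simp [Ne.symm hx]) (fun h => (h (Finset.mem_univ _)).elim)]
  simp only [if_true]

omit [DecidableEq ι] in
/-- Right action by a transpose: `(A · (bdiag W)ᵀ)(p,(y,j)) = Σ_i A(p,(y,i)) W(y)_{ji}`. [folklore] -/
theorem mul_bdiag_transpose_apply {Y : Type} [Fintype Y] [DecidableEq Y] (W : Y → Matrix ι ι ℝ) {Z : Type} (A : Matrix Z (Y × ι) ℝ) (p : Z) (q : Y × ι) :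
    (A * (bdiag W)ᵀ) p q = ∑ i, A p (q.1, i) * W q.1 q.2 i := by
  rw [Matrix.mul_apply, Fintype.sum_prod_type]
  simp only [bdiag, Matrix.transpose_apply, mul_ite, mul_zero]
  rw [Finset.sum_eq_single q.1 (fun y _ hy => by simp [Ne.symm hy]) (fun h => (h (Finset.mem_univ _)).elim)]
  simp only [if_true]

omit [DecidableEq ι] in
/-- Entries of a colour conjugate `P·A·Qᵀ`: `(P A Qᵀ)_{ij} = Σ_{j′} (Σ_{i′} P_{ii′}A_{i′j′}) Q_{jj′}`. [folklore] -/
theorem conj_apply (P A Q : Matrix ι ι ℝ) (i j : ι) : (P * A * Qᵀ) i j = ∑ j', (∑ i', P i i' * A i' j') * Q j j' := by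
  simp only [Matrix.mul_apply, Matrix.transpose_apply]

omit [DecidableEq ι] in
/-- A scaled colour conjugate read off a double sum: `Σ_{i′} (Σ_{j′} P_{ij′}·(c·A_{j′i′}))·Q_{ji′} = c·(P A Qᵀ)_{ij}`. [folklore] -/
theorem sum_conj_smul (c : ℝ) (P A Q : Matrix ι ι ℝ) (i j : ι) : ∑ i', (∑ j', P i j' * (c * A j' i')) * Q j i' = c * (P * A * Qᵀ) i j := by
  rw [conj_apply, Finset.mul_sum]
  refine Finset.sum_congr rfl fun i' _ => ?_
  rw [Finset.sum_mul, Finset.sum_mul, Finset.mul_sum]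
  exact Finset.sum_congr rfl fun j' _ => by ring

omit [DecidableEq ι] in
/-- Products of block-diagonal actions are fibrewise. [folklore] -/
theorem bdiag_mul_bdiag {X : Type} [Fintype X] [DecidableEq X] (W W' : X → Matrix ι ι ℝ) : bdiag W * bdiag W' = bdiag fun x => W x * W' x := by
  ext p q
  rw [bdiag_mul_apply]
  simp only [bdiag]
  by_cases h : p.1 = q.1
  · simp only [h, if_true, Matrix.mul_apply]
  · simp only [h, if_false, mul_zero, Finset.sum_const_zero]

omit [Fintype ι] in
/-- The identity action. [folklore] -/
theorem bdiag_one {X : Type} [DecidableEq X] : bdiag (fun _ : X => (1 : Matrix ι ι ℝ)) = 1 := by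
  ext p q
  simp only [bdiag, Matrix.one_apply, Prod.ext_iff]
  by_cases h1 : p.1 = q.1 <;> by_cases h2 : p.2 = q.2 <;> simp [h1, h2]

/-- Fibrewise orthogonal ⇒ orthogonal: `(bdiag W)ᵀ·bdiag W = 1`. [folklore] -/
theorem bdiag_orth {X : Type} [Fintype X] [DecidableEq X] {W : X → Matrix ι ι ℝ} (hW : ∀ x, (W x)ᵀ * W x = 1) : (bdiag W)ᵀ * bdiag W = 1 := by
  rw [bdiag_transpose, bdiag_mul_bdiag]
  simp only [hW]
  exact bdiag_one

/-- Fibrewise orthogonal ⇒ orthogonal on the other side: `bdiag W·(bdiag W)ᵀ = 1`. [folklore] -/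
theorem bdiag_orth' {X : Type} [Fintype X] [DecidableEq X] {W : X → Matrix ι ι ℝ} (hW : ∀ x, (W x)ᵀ * W x = 1) : bdiag W * (bdiag W)ᵀ = 1 := by
  rw [bdiag_transpose, bdiag_mul_bdiag]
  have h : ∀ x, W x * (W x)ᵀ = 1 := fun x => mul_eq_one_comm.mp (hW x)
  simp only [h]
  exact bdiag_one

/-- INVERSE OF AN ORTHOGONAL CONJUGATE (Mathlib's total inverse — no invertibility of `A` needed): `PᵀP = 1 = PPᵀ ⟹ (P·A·Pᵀ)⁻¹ = P·A⁻¹·Pᵀ`. [folklore] -/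
theorem inv_conj_orth {m : Type} [Fintype m] [DecidableEq m] {P : Matrix m m ℝ} (h1 : Pᵀ * P = 1) (h2 : P * Pᵀ = 1) (A : Matrix m m ℝ) :
    (P * A * Pᵀ)⁻¹ = P * A⁻¹ * Pᵀ := by
  rw [Matrix.mul_inv_rev, Matrix.mul_inv_rev, Matrix.inv_eq_left_inv h2, Matrix.inv_eq_left_inv h1, Matrix.mul_assoc]

end BDiag

/-! ## §2 Telescoping of the transports under a gauge transformation -/

section Telescope

variable {ι : Type} [Fintype ι] [DecidableEq ι]

/-- TELESCOPING OF A CONJUGATED ORDERED PRODUCT: `Π_t (W(z_t)·F_t·W(z_{t+1})ᵀ) = W(z_0)·(Π_t F_t)·W(z_N)ᵀ` for fibrewise orthogonal `W`. [folklore] -/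
theorem mprod_telescope {X : Type} (z : ℕ → X) {W : X → Matrix ι ι ℝ} (hW : ∀ x, (W x)ᵀ * W x = 1) (F : ℕ → Matrix ι ι ℝ) (N : ℕ) :
    mprod (fun t => W (z t) * F t * (W (z (t + 1)))ᵀ) N = W (z 0) * mprod F N * (W (z N))ᵀ := by
  induction N with
  | zero => rw [mprod_zero, mprod_zero, Matrix.mul_one, mul_eq_one_comm.mp (hW (z 0))]
  | succ N ih =>
      rw [mprod_succ, mprod_succ, ih]
      simp only [Matrix.mul_assoc]
      rw [← Matrix.mul_assoc (W (z N))ᵀ, hW, Matrix.one_mul]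

variable (M : Fin (d + 1) → ℕ) [∀ μ, NeZero (M μ)] (n : ℕ) [NeZero n]

/-- THE GAUGE ACTION ON A BOND-INDEXED TRANSPORTER DATUM (n15-c∕181's `T μ (z, ν)`): `T^W_μ(z, ν) = W(z)·T_μ(z, ν)·W(z + e_μ)ᵀ`.
[cite: Balaban1985BackgroundPropagators, (3.28) p.395 («U^u(x, x′) = u(x)U(x, x′)u⁻¹(x′)»: shape in `Ad`-coordinates)] -/
def gaugeTb (W : Tor (fine n M) → Matrix ι ι ℝ) (T : Fin (d + 1) → Tor (fine n M) × Fin (d + 1) → Matrix ι ι ℝ) :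
    Fin (d + 1) → Tor (fine n M) × Fin (d + 1) → Matrix ι ι ℝ :=
  fun μ b => W b.1 * T μ b * (W (b.1 + unitVec (fine n M) μ))ᵀ

/-- THE GAUGE ACTION ON A SITE TRANSPORTER DATUM: `T^W_ν(x) = W(x)·T_ν(x)·W(x + e_ν)ᵀ`. [cite: Balaban1985BackgroundPropagators, (3.28) p.395 (shape)] -/
def gaugeT (W : Tor (fine n M) → Matrix ι ι ℝ) (T : Fin (d + 1) → Tor (fine n M) → Matrix ι ι ℝ) : Fin (d + 1) → Tor (fine n M) → Matrix ι ι ℝ :=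
  fun ν x => W x * T ν x * (W (x + unitVec (fine n M) ν))ᵀ

omit [∀ μ, NeZero (M μ)] [NeZero n] [DecidableEq ι] in
/-- The site datum lifted to bonds commutes with the gauge action. [folklore] -/
theorem gaugeTb_lift (W : Tor (fine n M) → Matrix ι ι ℝ) (T : Fin (d + 1) → Tor (fine n M) → Matrix ι ι ℝ) :
    gaugeTb M n W (fun μ b => T μ b.1) = fun μ b => gaugeT M n W T μ b.1 := rfl

omit [∀ μ, NeZero (M μ)] in
/-- ONE STEP UP THE STAIRCASE IS `+ e_μ` on the offsets: `ι(stair a μ (t+1)) = ι(stair a μ t) + e_μ`. [folklore] -/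
theorem iota_stair_succ (a : Fin (d + 1) → Fin n) (μ : Fin (d + 1)) (t : ℕ) (ht : t + 1 < n) :
    iota n M (stair a μ ⟨t + 1, ht⟩) = iota n M (stair a μ ⟨t, Nat.lt_of_succ_lt ht⟩) + unitVec (fine n M) μ := by
  funext ν
  simp only [iota, unitVec, Pi.add_apply]
  by_cases hν : ν = μ
  · subst hν
    rw [stair_self, stair_self, Pi.single_eq_same]
    push_cast
    rfl
  · rw [Pi.single_eq_of_ne hν, add_zero]
    rcases lt_or_gt_of_ne hν with h | h
    · rw [stair_of_lt a _ h, stair_of_lt a _ h]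
    · rw [stair_of_gt a (⟨t + 1, ht⟩ : Fin n) h, stair_of_gt a (⟨t, Nat.lt_of_succ_lt ht⟩ : Fin n) h]

omit [∀ μ, NeZero (M μ)] in
/-- One step up the staircase on the fine torus: `n·y + stair(t+1) = (n·y + stair t) + e_μ`. [folklore] -/
theorem bpt_stair_succ (y : Tor M) (a : Fin (d + 1) → Fin n) (μ : Fin (d + 1)) (t : ℕ) (ht : t + 1 < n) :
    bpt n M y (stair a μ ⟨t + 1, ht⟩) = bpt n M y (stair a μ ⟨t, Nat.lt_of_succ_lt ht⟩) + unitVec (fine n M) μ := by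
  rw [bpt, bpt, iota_stair_succ, add_assoc]

omit M in
/-- LEGS ABUT: the top of leg `μ` (height `a_μ`) is the bottom of leg `μ+1` (height `0`): both are the offset `(a_0, …, a_μ, 0, …, 0)`. [folklore] -/
theorem stair_leg_end (a : Fin (d + 1) → Fin n) (μ : Fin (d + 1)) (hμ : (μ : ℕ) + 1 < d + 1) (t : Fin n) (ht : (t : ℕ) = a μ) :
    stair a μ t = stair a ⟨μ + 1, hμ⟩ ⟨0, Nat.pos_of_ne_zero (NeZero.ne n)⟩ := by
  funext ν
  by_cases h1 : ν < μ
  · rw [stair_of_lt a _ h1, stair_of_lt a _ (lt_trans h1 (Fin.lt_def.mpr (by simp)))]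
  · rcases eq_or_lt_of_le (not_lt.mp h1) with h2 | h2
    · subst h2; rw [stair_self, stair_of_lt a _ (Fin.lt_def.mpr (by simp))]; exact Fin.ext ht
    · apply Fin.ext
      rw [stair_of_gt a _ h2]
      rcases eq_or_lt_of_le (Nat.succ_le_of_lt (Fin.lt_def.mp h2)) with h3 | h3
      · rw [← (Fin.ext h3 : (⟨(μ : ℕ) + 1, hμ⟩ : Fin (d + 1)) = ν), stair_self]
      · rw [stair_of_gt a _ (Fin.lt_def.mpr h3)]

omit M in
/-- The staircase starts at the corner: `stair a 0 0 = 0`. [folklore] -/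
theorem stair_zero (a : Fin (d + 1) → Fin n) : stair a ⟨0, Nat.zero_lt_succ _⟩ ⟨0, Nat.pos_of_ne_zero (NeZero.ne n)⟩ = 0 := by
  funext μ
  apply Fin.ext
  rcases Nat.eq_zero_or_pos (μ : ℕ) with hμ | hμ
  · have : μ = ⟨0, Nat.zero_lt_succ _⟩ := Fin.ext hμ
    subst this; rw [stair_self]; simp
  · rw [stair_of_gt a _ (Fin.lt_def.mpr hμ)]; simp

omit M in
/-- The staircase ends at the target: on the last leg at height `a_d` the offset is `a`. [folklore] -/
theorem stair_last (a : Fin (d + 1) → Fin n) (h : d < d + 1) : stair a ⟨d, h⟩ ⟨(a ⟨d, h⟩ : ℕ) % n, Nat.mod_lt _ (Nat.pos_of_ne_zero (NeZero.ne n))⟩ = a := by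
  funext μ
  rcases lt_trichotomy μ ⟨d, h⟩ with hμ | hμ | hμ
  · exact stair_of_lt a _ hμ
  · subst hμ; rw [stair_self]; exact Fin.ext (Nat.mod_eq_of_lt (a _).isLt)
  · exact absurd (Fin.lt_def.mp hμ) (by simp only [not_lt]; exact Nat.le_of_lt_succ μ.isLt)

omit [∀ μ, NeZero (M μ)] in
/-- ★ THE LEG TRANSPORT IS CONJUGATED: `cvaLeg (T^W) y a μ ν = W(bottom)·cvaLeg T y a μ ν·W(top)ᵀ`, bottom = `n·y + stair a μ 0`, top = the site at height `a_μ`.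
[cite: Balaban1985BackgroundPropagators, (3.32) p.395 (mechanism)] -/
theorem cvaLeg_gauge {W : Tor (fine n M) → Matrix ι ι ℝ} (hW : ∀ x, (W x)ᵀ * W x = 1) (T : Fin (d + 1) → Tor (fine n M) × Fin (d + 1) → Matrix ι ι ℝ)
    (y : Tor M) (a : Fin (d + 1) → Fin n) (μ ν : Fin (d + 1)) :
    cvaLeg M n (gaugeTb M n W T) y a μ ν =
      W (bpt n M y (stair a μ ⟨0, Nat.pos_of_ne_zero (NeZero.ne n)⟩)) * cvaLeg M n T y a μ ν *
        (W (bpt n M y (stair a μ ⟨(a μ : ℕ) % n, Nat.mod_lt _ (Nat.pos_of_ne_zero (NeZero.ne n))⟩)))ᵀ := by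
  have hn : 0 < n := Nat.pos_of_ne_zero (NeZero.ne n)
  have hfac : ∀ t, t < (a μ : ℕ) → gaugeTb M n W T μ (bondAt n M y a μ ν t) =
      W ((fun s : ℕ => bpt n M y (stair a μ ⟨s % n, Nat.mod_lt _ hn⟩)) t) * T μ (bondAt n M y a μ ν t) *
        (W ((fun s : ℕ => bpt n M y (stair a μ ⟨s % n, Nat.mod_lt _ hn⟩)) (t + 1)))ᵀ := by
    intro t ht
    have ht1 : t + 1 < n := lt_of_le_of_lt (Nat.succ_le_of_lt ht) (a μ).isLt
    have htn : t < n := Nat.lt_of_succ_lt ht1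
    have hs : (bondAt n M y a μ ν t).1 + unitVec (fine n M) μ = bpt n M y (stair a μ ⟨(t + 1) % n, Nat.mod_lt _ hn⟩) := by
      simp only [bondAt, Nat.mod_eq_of_lt htn, Nat.mod_eq_of_lt ht1]
      exact (bpt_stair_succ M n y a μ t ht1).symm
    rw [gaugeTb, hs]
    rfl
  rw [cvaLeg, cvaLeg, mprod_congr hfac, mprod_telescope _ hW]
  simp only [Nat.zero_mod]

omit [∀ μ, NeZero (M μ)] in
/-- ★ **THE STAIRCASE TRANSPORT IS CONJUGATED**: `cvaStair (T^W) y a ν = W(n·y)·cvaStair T y a ν·W(n·y + a)ᵀ` — «R(U^u(Γ_{y,x})) = R(u(y))R(U(Γ_{y,x}))R(u⁻¹(x))».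
[cite: Balaban1985BackgroundPropagators, (3.32) p.395] -/
theorem cvaStair_gauge {W : Tor (fine n M) → Matrix ι ι ℝ} (hW : ∀ x, (W x)ᵀ * W x = 1) (T : Fin (d + 1) → Tor (fine n M) × Fin (d + 1) → Matrix ι ι ℝ)
    (y : Tor M) (a : Fin (d + 1) → Fin n) (ν : Fin (d + 1)) :
    cvaStair M n (gaugeTb M n W T) y a ν = W (bpt n M y 0) * cvaStair M n T y a ν * (W (bpt n M y a))ᵀ := by
  have hn : 0 < n := Nat.pos_of_ne_zero (NeZero.ne n)
  -- the leg start points as a function of the natural leg index: leg `i` starts at the offset `(a_0,…,a_{i−1},0,…,0)`; index `≥ d+1` ↦ the endpoint `a`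
  set z : ℕ → Tor (fine n M) := fun i => if h : i < d + 1 then bpt n M y (stair a ⟨i, h⟩ ⟨0, hn⟩) else bpt n M y a with hz
  have hzi : ∀ (i : ℕ) (h : i < d + 1), z i = bpt n M y (stair a ⟨i, h⟩ ⟨0, hn⟩) := fun i h => by rw [hz]; exact dif_pos h
  have htop : ∀ (i : ℕ) (h : i < d + 1), bpt n M y (stair a ⟨i, h⟩ ⟨(a ⟨i, h⟩ : ℕ) % n, Nat.mod_lt _ hn⟩) = z (i + 1) := by
    intro i h
    by_cases h' : i + 1 < d + 1
    · rw [hzi (i + 1) h', stair_leg_end n a ⟨i, h⟩ h' _ (Nat.mod_eq_of_lt (a ⟨i, h⟩).isLt)]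
    · have hi : i = d := by omega
      have hzd : z (i + 1) = bpt n M y a := by rw [hz]; exact dif_neg h'
      rw [hzd]; congr 1
      have hlast := stair_last n a (Nat.lt_succ_self d); revert hlast h; rw [hi]; exact fun h hlast => hlast
  have hfac : ∀ i < d + 1, (if h : i < d + 1 then cvaLeg M n (gaugeTb M n W T) y a ⟨i, h⟩ ν else 1) =
      W (z i) * (if h : i < d + 1 then cvaLeg M n T y a ⟨i, h⟩ ν else 1) * (W (z (i + 1)))ᵀ := by
    intro i hi
    rw [dif_pos hi, dif_pos hi, cvaLeg_gauge M n hW, htop i hi, hzi i hi]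
  have hz0 : z 0 = bpt n M y 0 := by rw [hzi 0 (Nat.zero_lt_succ _), stair_zero]
  have hzN : z (d + 1) = bpt n M y a := by rw [hz]; exact dif_neg (lt_irrefl _)
  rw [cvaStair, cvaStair, mprod_congr hfac, mprod_telescope z hW, hz0, hzN]

omit [∀ μ, NeZero (M μ)] [NeZero n] in
/-- ★ THE LINE TRANSPORT IS CONJUGATED: `cvaLine (T^W) p s = W(p.1)·cvaLine T p s·W(p.1 + s·e_μ)ᵀ`. [cite: Balaban1985BackgroundPropagators, (3.32) p.395 (mechanism)] -/
theorem cvaLine_gauge {W : Tor (fine n M) → Matrix ι ι ℝ} (hW : ∀ x, (W x)ᵀ * W x = 1) (T : Fin (d + 1) → Tor (fine n M) × Fin (d + 1) → Matrix ι ι ℝ)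
    (p : Tor (fine n M) × Fin (d + 1)) (s : ℕ) :
    cvaLine M n (gaugeTb M n W T) p s = W p.1 * cvaLine M n T p s * (W (p.1 + s • unitVec (fine n M) p.2))ᵀ := by
  have hfac : ∀ t < s, gaugeTb M n W T p.2 (p.1 + t • unitVec (fine n M) p.2, p.2) =
      W ((fun t : ℕ => p.1 + t • unitVec (fine n M) p.2) t) * T p.2 (p.1 + t • unitVec (fine n M) p.2, p.2) * (W ((fun t : ℕ => p.1 + t • unitVec (fine n M) p.2) (t + 1)))ᵀ := by
    intro t _
    simp only [gaugeTb, add_smul, one_smul, add_assoc]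
  rw [cvaLine, cvaLine, mprod_congr hfac, mprod_telescope _ hW]
  simp only [zero_smul, add_zero]

/-- ★ THE PATH TRANSPORT OF (125) IS CONJUGATED: `cvaPath (T^W) p s = W(n·y(p))·cvaPath T p s·W(p.1 + s·e_μ)ᵀ` (base point of `p`'s block to the far end of the line).
[cite: Balaban1985BackgroundPropagators, (3.32) p.395; Balaban1985Averaging, (125) p.36] -/
theorem cvaPath_gauge {W : Tor (fine n M) → Matrix ι ι ℝ} (hW : ∀ x, (W x)ᵀ * W x = 1) (T : Fin (d + 1) → Tor (fine n M) × Fin (d + 1) → Matrix ι ι ℝ)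
    (p : Tor (fine n M) × Fin (d + 1)) (s : ℕ) :
    cvaPath M n (gaugeTb M n W T) p s = W (bpt n M (blockCoords n M p.1).1 0) * cvaPath M n T p s * (W (p.1 + s • unitVec (fine n M) p.2))ᵀ := by
  rw [cvaPath, cvaPath, cvaStair_gauge M n hW, cvaLine_gauge M n hW, bpt_blockCoords]
  simp only [Matrix.mul_assoc]
  rw [← Matrix.mul_assoc (W p.1)ᵀ, hW, Matrix.one_mul]

end Telescope

/-! ## §3 The conjugation laws (3.31)–(3.34) for `D`, `Q′`, `Δ′_a`, `G′`, `Q′G′²Q′*`, `I − R`, `R`, and `D(I − R)D*` -/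

section Laws

variable (M : Fin (d + 1) → ℕ) [∀ μ, NeZero (M μ)] (n : ℕ) [NeZero n] {ι : Type} [Fintype ι] [DecidableEq ι]

/-- ★ **(3.31), first-order form: THE COVARIANT GRADIENT IS CONJUGATED** — `D_{T^W} = 𝕎₁·D_T·𝕎₀ᵀ` (`𝕎₁ = bdiag (W ∘ bond base point)`, `𝕎₀ = bdiag W`).
[cite: Balaban1985BackgroundPropagators, (3.31) p.395] -/
theorem cgrad_gauge {W : Tor (fine n M) → Matrix ι ι ℝ} (hW : ∀ x, (W x)ᵀ * W x = 1) (T : Fin (d + 1) → Tor (fine n M) → Matrix ι ι ℝ) :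
    cgrad M n (gaugeT M n W T) = bdiag (fun p : Tor (fine n M) × Fin (d + 1) => W p.1) * cgrad M n T * (bdiag W)ᵀ := by
  have hWW : ∀ x, W x * (W x)ᵀ = 1 := fun x => mul_eq_one_comm.mp (hW x)
  ext ⟨⟨x, ν⟩, i⟩ ⟨y, j⟩
  -- read the summand of `cgrad T` as the entry of ONE matrix `C = [y = x+e_ν]·T_ν(x) − [x = y]·1`
  have hC : ∀ j' i' : ι, (n : ℝ) * ((if y = x + unitVec (fine n M) ν then T ν x j' i' else 0) - if x = y then (1 : Matrix ι ι ℝ) j' i' else 0)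
      = (n : ℝ) * (((if y = x + unitVec (fine n M) ν then T ν x else 0) - (if x = y then (1 : Matrix ι ι ℝ) else 0)) j' i') := by
    intro j' i'; rw [Matrix.sub_apply]; congr 2 <;> split_ifs <;> rfl
  rw [mul_bdiag_transpose_apply]
  simp only [bdiag_mul_apply, cgrad, gaugeT, hC]
  rw [sum_conj_smul, Matrix.mul_sub, Matrix.sub_mul, Matrix.sub_apply]
  congr 1
  congr 1
  · split_ifs with h
    · rw [h]
    · simp
  · split_ifs with h
    · rw [Matrix.mul_one, ← h, hWW]
    · simp

/-- ★ **(3.32): THE COVARIANT BLOCK AVERAGING IS CONJUGATED** — `Q′_{T^W} = 𝕎_c·Q′_T·𝕎₀ᵀ`, `𝕎_c = bdiag (W ∘ block base point)`: «(Q′_j(U^u)R(u)λ)(y) = R(u(y))(Q′_j(U)λ)(y)».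
[cite: Balaban1985BackgroundPropagators, (3.32) p.395] -/
theorem csavg_gauge {W : Tor (fine n M) → Matrix ι ι ℝ} (hW : ∀ x, (W x)ᵀ * W x = 1) (T : Fin (d + 1) → Tor (fine n M) → Matrix ι ι ℝ) :
    csavg M n (gaugeT M n W T) = bdiag (fun y : Tor M => W (bpt n M y 0)) * csavg M n T * (bdiag W)ᵀ := by
  ext ⟨y, i⟩ ⟨x, j⟩
  rw [mul_bdiag_transpose_apply]
  simp only [bdiag_mul_apply, csavg]
  by_cases hb : blockOf n M x = y
  · simp only [hb, if_true]
    have h1 := bpt_blockCoords n M x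
    have h2 : (blockCoords n M x).1 = y := by rw [← hb, ← h1, kingBlockOf_bpt, h1]
    have hx : bpt n M y (blockCoords n M x).2 = x := by rw [← h2]; exact h1
    rw [← gaugeTb_lift, cvaStair_gauge M n hW, hx, sum_conj_smul]
  · simp only [hb, if_false, mul_zero, zero_mul, Finset.sum_const_zero]

/-- (3.31)∕(3.24): `Δ′_a(U^u) = 𝕎₀·Δ′_a(U)·𝕎₀ᵀ`. [cite: Balaban1985BackgroundPropagators, (3.31) p.395, (3.24) p.394] -/
theorem claplA_gauge {W : Tor (fine n M) → Matrix ι ι ℝ} (hW : ∀ x, (W x)ᵀ * W x = 1) (T : Fin (d + 1) → Tor (fine n M) → Matrix ι ι ℝ) (a : ℝ) :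
    claplA M n (gaugeT M n W T) a = bdiag W * claplA M n T a * (bdiag W)ᵀ := by
  have h1 : (bdiag (fun p : Tor (fine n M) × Fin (d + 1) => W p.1))ᵀ * bdiag (fun p : Tor (fine n M) × Fin (d + 1) => W p.1) = 1 := bdiag_orth fun p => hW p.1
  have hc : (bdiag (fun y : Tor M => W (bpt n M y 0)))ᵀ * bdiag (fun y : Tor M => W (bpt n M y 0)) = 1 := bdiag_orth fun y => hW _
  rw [claplA, claplA, cgrad_gauge M n hW, csavg_gauge M n hW]
  simp only [Matrix.transpose_mul, Matrix.transpose_transpose, Matrix.mul_add, Matrix.add_mul, Matrix.mul_smul, Matrix.smul_mul, Matrix.mul_assoc]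
  rw [← Matrix.mul_assoc (bdiag fun p : Tor (fine n M) × Fin (d + 1) => W p.1)ᵀ, h1, Matrix.one_mul,
    ← Matrix.mul_assoc (bdiag fun y : Tor M => W (bpt n M y 0))ᵀ, hc, Matrix.one_mul]

/-- (3.33)₁: `G′(U^u) = 𝕎₀·G′(U)·𝕎₀ᵀ` (Mathlib's total inverse; no invertibility needed). [cite: Balaban1985BackgroundPropagators, (3.33) p.396] -/
theorem cGreen_gauge {W : Tor (fine n M) → Matrix ι ι ℝ} (hW : ∀ x, (W x)ᵀ * W x = 1) (T : Fin (d + 1) → Tor (fine n M) → Matrix ι ι ℝ) (a : ℝ) :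
    cGreen M n (gaugeT M n W T) a = bdiag W * cGreen M n T a * (bdiag W)ᵀ := by
  rw [cGreen, cGreen, claplA_gauge M n hW, inv_conj_orth (bdiag_orth hW) (bdiag_orth' hW)]

/-- `Q′G′²Q′*` is conjugated by `𝕎_c`. [cite: Balaban1985BackgroundPropagators, (3.32)–(3.33) pp.395–396] -/
theorem cSop_gauge {W : Tor (fine n M) → Matrix ι ι ℝ} (hW : ∀ x, (W x)ᵀ * W x = 1) (T : Fin (d + 1) → Tor (fine n M) → Matrix ι ι ℝ) (a : ℝ) :
    cSop M n (gaugeT M n W T) a = bdiag (fun y : Tor M => W (bpt n M y 0)) * cSop M n T a * (bdiag (fun y : Tor M => W (bpt n M y 0)))ᵀ := by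
  have h0 : (bdiag W)ᵀ * bdiag W = 1 := bdiag_orth hW
  rw [cSop, cSop, cGreen_gauge M n hW, csavg_gauge M n hW]
  simp only [Matrix.transpose_mul, Matrix.transpose_transpose, Matrix.mul_assoc]
  rw [← Matrix.mul_assoc (bdiag W)ᵀ, h0, Matrix.one_mul, ← Matrix.mul_assoc (bdiag W)ᵀ, h0, Matrix.one_mul, ← Matrix.mul_assoc (bdiag W)ᵀ, h0, Matrix.one_mul]

/-- ★ (3.33)₂ for the complementary projection: `(I − R)(U^u) = 𝕎₀·(I − R)(U)·𝕎₀ᵀ`. [cite: Balaban1985BackgroundPropagators, (3.33) p.396] -/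
theorem cPi_gauge {W : Tor (fine n M) → Matrix ι ι ℝ} (hW : ∀ x, (W x)ᵀ * W x = 1) (T : Fin (d + 1) → Tor (fine n M) → Matrix ι ι ℝ) (a : ℝ) :
    cPi M n (gaugeT M n W T) a = bdiag W * cPi M n T a * (bdiag W)ᵀ := by
  have h0 : (bdiag W)ᵀ * bdiag W = 1 := bdiag_orth hW
  have hc : (bdiag (fun y : Tor M => W (bpt n M y 0)))ᵀ * bdiag (fun y : Tor M => W (bpt n M y 0)) = 1 := bdiag_orth fun y => hW _
  have hc' : bdiag (fun y : Tor M => W (bpt n M y 0)) * (bdiag (fun y : Tor M => W (bpt n M y 0)))ᵀ = 1 := bdiag_orth' fun y => hW _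
  rw [cPi, cPi, cGreen_gauge M n hW, csavg_gauge M n hW, cSop_gauge M n hW, inv_conj_orth hc hc']
  simp only [Matrix.transpose_mul, Matrix.transpose_transpose, Matrix.mul_assoc]
  rw [← Matrix.mul_assoc (bdiag W)ᵀ, h0, Matrix.one_mul, ← Matrix.mul_assoc (bdiag fun y : Tor M => W (bpt n M y 0))ᵀ, hc, Matrix.one_mul,
    ← Matrix.mul_assoc (bdiag fun y : Tor M => W (bpt n M y 0))ᵀ, hc, Matrix.one_mul, ← Matrix.mul_assoc (bdiag W)ᵀ, h0, Matrix.one_mul]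

/-- ★ **(3.33)₂: `R(U^u) = 𝕎₀·R(U)·𝕎₀ᵀ`** — «R(U^u) = R(u)R(U)R(u⁻¹)». [cite: Balaban1985BackgroundPropagators, (3.33) p.396] -/
theorem cR_gauge {W : Tor (fine n M) → Matrix ι ι ℝ} (hW : ∀ x, (W x)ᵀ * W x = 1) (T : Fin (d + 1) → Tor (fine n M) → Matrix ι ι ℝ) (a : ℝ) :
    cR M n (gaugeT M n W T) a = bdiag W * cR M n T a * (bdiag W)ᵀ := by
  rw [cR, cR, cPi_gauge M n hW, Matrix.mul_sub, Matrix.sub_mul, Matrix.mul_one, bdiag_orth' hW]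

/-- ★★ **(3.34) FOR THE LANDAU SUMMAND: THE COVARIANT LANDAU TERM IS CONJUGATED — `D(I−R)D*(U^u) = 𝕎₁·D(I−R)D*(U)·𝕎₁ᵀ`**, `𝕎₁ = bdiag (W ∘ bond base point)`: FILE 120's `hP` row
for the Landau summand with the per-cube gauge LIVE. [cite: Balaban1985BackgroundPropagators, (3.34) p.396] -/
theorem landauCov_gauge {W : Tor (fine n M) → Matrix ι ι ℝ} (hW : ∀ x, (W x)ᵀ * W x = 1) (T : Fin (d + 1) → Tor (fine n M) → Matrix ι ι ℝ) (a : ℝ) :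
    landauCov M n (gaugeT M n W T) a =
      bdiag (fun p : Tor (fine n M) × Fin (d + 1) => W p.1) * landauCov M n T a * (bdiag (fun p : Tor (fine n M) × Fin (d + 1) => W p.1))ᵀ := by
  have h0 : (bdiag W)ᵀ * bdiag W = 1 := bdiag_orth hW
  rw [landauCov, landauCov, cgrad_gauge M n hW, cPi_gauge M n hW]
  simp only [Matrix.transpose_mul, Matrix.transpose_transpose, Matrix.mul_assoc]
  rw [← Matrix.mul_assoc (bdiag W)ᵀ, h0, Matrix.one_mul, ← Matrix.mul_assoc (bdiag W)ᵀ, h0, Matrix.one_mul]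

end Laws

end Summit.QuantumFields.YangMills.BalabanUVNodes.N15.CovLandau

end
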